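import Mathlib.Analysis.Calculus.FDeriv.ContinuousAlternatingMap
import Mathlib.Analysis.Calculus.DifferentialForm.Basic
import Mathlib.Geometry.Manifold.VectorField.LieBracket
import Literature.Geometry.Kaehler.ManifoldForms
import HarnessLib

/-!
# The exterior derivative of a 1-form evaluated on two vector fields (manifold case)

Topic `Literature/Geometry/Kaehler` (vocabulary of `ManifoldForms`: `MForm I M F k`, the chart
representative `MForm.inChart`, the exterior derivative `mextDeriv`).

**Warner 1983, Prop. 2.25 (f)** for `p = 1`: for a smooth 1-form `ω` and smooth vector fields
`Y₀, Y₁` on a manifold,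

  `dω(Y₀, Y₁) = Y₀ (ω(Y₁)) - Y₁ (ω(Y₀)) - ω([Y₀, Y₁])`

(the "invariant formula" for `d` in degree one; normalisation of `d` as in Mathlib's `extDeriv`,
which is Warner's). Mathlib has the normed-space case in every degree
(`extDerivWithin_apply_vectorField`); the tree's `mextDeriv` (Warner, 2.20: `d` on a manifold is
computed in a chart) had no evaluation formula on vector fields. We prove the degree-one manifold
statement `Literature.Geometry.Kaehler.mextDeriv_apply_vectorField` by transporting the
normed-space identity through the extended chart at the point: the chart representatives of the
fields are Mathlib's `mpullbackWithin` by the inverse extended chart (exactly as in the definition of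
`VectorField.mlieBracket`), the function `y ↦ ω_y(Y y)` read in the chart is the representative
`ω.inChart x₀` evaluated on the representative field (`MForm.apply_vectorField_eventuallyEq_inChart`),
and at the base point all the identifications are the identity (`mfderiv_extChartAt_self`,
`mfderivWithin_range_extChartAt_symm`).

Hypotheses are pointwise and minimal: the chart representative `ω.inChart x₀` is differentiable
within `range I` at the image of `x₀` (e.g. `ω` smooth, `IsSmoothForm`), and the two fields are
differentiable at `x₀` as sections of the tangent bundle. Also recorded: the manifold derivative of
`y ↦ ω_y(Y y)` at `x₀` in the chart (`MForm.hasMFDerivAt_apply_vectorField`), whence its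
differentiability. 0 new facts.

## What is NOT here

Higher degrees (the general Prop. 2.25 (f)); the Lie derivative and Cartan's formula 2.25 (d).

## References

* F. W. Warner, *Foundations of Differentiable Manifolds and Lie Groups*, GTM 94, Springer (1983),
  Prop. 2.25 (f) (p. 70) and 2.20 (local computation of `d`). [Warner1983]
-/

noncomputable section

open Set Function Filter VectorField
open scoped Manifold ContDiff Topology

namespace Literature.Geometry.Kaehler

variable {E : Type*} [NormedAddCommGroup E] [NormedSpace ℝ E]
  {H : Type*} [TopologicalSpace H] {I : ModelWithCorners ℝ E H}
  {M : Type*} [TopologicalSpace M] [ChartedSpace H M]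
  {F : Type*} [NormedAddCommGroup F] [NormedSpace ℝ F]

/-! ### Small algebraic helpers -/

/-- Transport of the value of a form along an equality of base points (all tangent spaces are the
model space `E` definitionally); a local copy of the tree's `MForm.apply_congr_point`
(`FormIntegrationPullbackCharts`), kept private to avoid the import. [folklore] -/
private theorem MForm.apply_eq_of_eq_point {k : ℕ} (α : MForm I M F k) {p q : M} (h : p = q) (w : Fin k → E) :
    α p w = α q w := by
  subst h
  rfl

/-- A `Fin 1`-vector is the constant function: Mathlib's `Matrix.vec_single_eq_const`, kept as a
deprecated alias. [folklore] -/
@[deprecated Matrix.vec_single_eq_const (since := "2026-08-16")]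
alias vecOne_eq_const := Matrix.vec_single_eq_const

/-- A continuous alternating map on `Fin 1`-vectors is linear in its single slot: it respects
differences. [folklore] -/
theorem ContinuousAlternatingMap.apply_const_sub {𝕜 V W : Type*} [NontriviallyNormedField 𝕜]
    [NormedAddCommGroup V] [NormedSpace 𝕜 V] [NormedAddCommGroup W] [NormedSpace 𝕜 W]
    (f : V [⋀^Fin 1]→L[𝕜] W) (a b : V) :
    f (fun _ ↦ a - b) = f (fun _ ↦ a) - f (fun _ ↦ b) := by
  have h := f.map_update_sub (fun _ ↦ a) 0 a b
  rw [Function.update_eq_const_of_subsingleton, Function.update_eq_const_of_subsingleton,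
    Function.update_eq_const_of_subsingleton] at h
  exact h

/-- An invertible continuous linear map followed by its `inverse` is the identity. This is Mathlib's
`ContinuousLinearMap.IsInvertible.self_apply_inverse`; kept as a deprecated alias (dedup-02449).
[folklore] -/
@[deprecated ContinuousLinearMap.IsInvertible.self_apply_inverse (since := "2026-08-16")]
theorem apply_inverse_of_isInvertible {V W : Type*} [TopologicalSpace V] [AddCommMonoid V] [Module ℝ V]
    [TopologicalSpace W] [AddCommMonoid W] [Module ℝ W] {A : V →L[ℝ] W} (hA : A.IsInvertible) (w : W) :
    A (A.inverse w) = w :=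
  hA.self_apply_inverse w

/-! ### Chart representatives -/

section Chart

variable [IsManifold I 2 M]

/-- **The function `y ↦ ω_y(Y y)` read in the extended chart at `x₀`.** Near `x₀` it is the chart
representative `ω.inChart x₀` evaluated at `extChartAt I x₀ y` on the chart representative
`mpullbackWithin 𝓘(ℝ, E) I (extChartAt I x₀).symm Y (range I)` of the field (the pull-back by the
inverse extended chart used in Mathlib's `VectorField.mlieBracket`) (local expressions as in
Warner 1983, 2.18 and the proof of 2.20). [folklore] -/
theorem MForm.apply_vectorField_eventuallyEq_inChart (α : MForm I M F 1) (x₀ : M)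
    (Y : Π x : M, TangentSpace I x) :
    ∀ᶠ y in 𝓝 x₀, α y ![Y y] =
      α.inChart x₀ (extChartAt I x₀ y)
        (fun _ ↦ mpullbackWithin 𝓘(ℝ, E) I (extChartAt I x₀).symm Y (range I) (extChartAt I x₀ y)) := by
  filter_upwards [extChartAt_source_mem_nhds (I := I) x₀] with y hy
  have hyt : extChartAt I x₀ y ∈ (extChartAt I x₀).target := (extChartAt I x₀).map_source hy
  have hA := isInvertible_mfderivWithin_extChartAt_symm (I := I) hyt
  rw [MForm.inChart_apply, mpullbackWithin_apply]
  simp only [hA.self_apply_inverse]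
  rw [(extChartAt I x₀).left_inv hy, Matrix.vec_single_eq_const]

/-- **The manifold derivative of `y ↦ ω_y(Y y)` at `x₀`, in the chart.** If the chart representative
`ω.inChart x₀` is differentiable within `range I` at the image `z₀` of `x₀` and `Y` is differentiable
at `x₀`, then `y ↦ ω_y(Y y)` has at `x₀` the manifold derivative
`fderivWithin ℝ (z ↦ (ω.inChart x₀ z)(Y' z)) (range I) z₀`, `Y'` the chart representative of `Y`
(the chain rule through the extended chart, whose derivative at its base point is the identity,
Mathlib's `mfderiv_extChartAt_self`). [folklore] -/
theorem MForm.hasMFDerivAt_apply_vectorField [CompleteSpace E] {α : MForm I M F 1} {x₀ : M}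
    (hα : DifferentiableWithinAt ℝ (α.inChart x₀) (range I) (extChartAt I x₀ x₀))
    {Y : Π x : M, TangentSpace I x}
    (hY : MDifferentiableAt I (I.prod 𝓘(ℝ, E)) (fun y ↦ (Y y : TangentBundle I M)) x₀) :
    HasMFDerivAt I 𝓘(ℝ, F) (fun y ↦ α y ![Y y]) x₀
      (fderivWithin ℝ (fun z ↦ α.inChart x₀ z
        (fun _ ↦ mpullbackWithin 𝓘(ℝ, E) I (extChartAt I x₀).symm Y (range I) z)) (range I)
        (extChartAt I x₀ x₀)) := by
  set φ := extChartAt I x₀ with hφ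
  set Y' : E → E := mpullbackWithin 𝓘(ℝ, E) I φ.symm Y (range I) with hY'
  set G : E → F := fun z ↦ α.inChart x₀ z (fun _ ↦ Y' z) with hG
  have hY'd : DifferentiableWithinAt ℝ Y' (range I) (φ x₀) := by
    have h := MDifferentiableWithinAt.differentiableWithinAt_mpullbackWithin_vectorField (I := I)
      (s := univ) (V := Y) (x := x₀) (mdifferentiableWithinAt_univ.2 hY)
    simpa only [preimage_univ, univ_inter] using h
  have hGd : DifferentiableWithinAt ℝ G (range I) (φ x₀) :=
    hα.continuousAlternatingMap_apply (g := fun _ : Fin 1 ↦ Y') fun _ ↦ hY'd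
  have hGm : HasMFDerivWithinAt 𝓘(ℝ, E) 𝓘(ℝ, F) G (range I) (φ x₀) (fderivWithin ℝ G (range I) (φ x₀)) :=
    hGd.hasFDerivWithinAt.hasMFDerivWithinAt
  have hφm : HasMFDerivWithinAt I 𝓘(ℝ, E) φ univ x₀ (ContinuousLinearMap.id ℝ E) := by
    have h := (mdifferentiableAt_extChartAt (I := I) (mem_chart_source H x₀)).hasMFDerivAt
    rw [mfderiv_extChartAt_self] at h
    exact h.hasMFDerivWithinAt
  have hst : (univ : Set M) ⊆ φ ⁻¹' range I := fun y _ ↦ by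
    rw [mem_preimage, hφ, extChartAt_coe]
    exact mem_range_self _
  have hcomp := HasMFDerivWithinAt.comp x₀ hGm hφm hst
  rw [hasMFDerivWithinAt_univ] at hcomp
  refine (hcomp.congr_mfderiv ?_).congr_of_eventuallyEq ?_
  · ext v
    rfl
  · filter_upwards [α.apply_vectorField_eventuallyEq_inChart x₀ Y] with y hy
    exact hy

/-- `y ↦ ω_y(Y y)` is differentiable at `x₀` under the hypotheses of
`MForm.hasMFDerivAt_apply_vectorField`. [folklore] -/
theorem MForm.mdifferentiableAt_apply_vectorField [CompleteSpace E] {α : MForm I M F 1} {x₀ : M}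
    (hα : DifferentiableWithinAt ℝ (α.inChart x₀) (range I) (extChartAt I x₀ x₀))
    {Y : Π x : M, TangentSpace I x}
    (hY : MDifferentiableAt I (I.prod 𝓘(ℝ, E)) (fun y ↦ (Y y : TangentBundle I M)) x₀) :
    MDifferentiableAt I 𝓘(ℝ, F) (fun y ↦ α y ![Y y]) x₀ :=
  (MForm.hasMFDerivAt_apply_vectorField hα hY).mdifferentiableAt

/-- The value of `Y (ω(Z))` at `x₀`, read in the chart: with `G z = (ω.inChart x₀ z)(Z' z)`,
`d(ω(Z))_{x₀}(v) = fderivWithin ℝ G (range I) z₀ v` (Mathlib's `mvfderiv`). [folklore] -/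
theorem MForm.mvfderiv_apply_vectorField [CompleteSpace E] {α : MForm I M F 1} {x₀ : M}
    (hα : DifferentiableWithinAt ℝ (α.inChart x₀) (range I) (extChartAt I x₀ x₀))
    {Y : Π x : M, TangentSpace I x}
    (hY : MDifferentiableAt I (I.prod 𝓘(ℝ, E)) (fun y ↦ (Y y : TangentBundle I M)) x₀)
    (v : TangentSpace I x₀) :
    mvfderiv I (fun y ↦ α y ![Y y]) x₀ v =
      fderivWithin ℝ (fun z ↦ α.inChart x₀ z
        (fun _ ↦ mpullbackWithin 𝓘(ℝ, E) I (extChartAt I x₀).symm Y (range I) z)) (range I)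
        (extChartAt I x₀ x₀) v := by
  unfold mvfderiv
  rw [(MForm.hasMFDerivAt_apply_vectorField hα hY).mfderiv]
  rfl

/-- At the base point the chart representative of a field is the field:
`Y'(z₀) = Y(x₀)` (Mathlib's `mfderivWithin_extChartAt_symm_inverse_apply`). [folklore] -/
theorem mpullbackWithin_extChartAt_symm_apply_self (x₀ : M) (Y : Π x : M, TangentSpace I x) :
    mpullbackWithin 𝓘(ℝ, E) I (extChartAt I x₀).symm Y (range I) (extChartAt I x₀ x₀) = Y x₀ := by
  rw [mpullbackWithin_apply, extChartAt_to_inv x₀]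
  exact mfderivWithin_extChartAt_symm_inverse_apply (Y x₀)

/-- At the base point the chart representative of a 1-form is the form:
`(ω.inChart x₀ z₀) w = ω_{x₀} w` (Mathlib's `mfderivWithin_range_extChartAt_symm`); the applied,
`C²`-atlas form of the tree's `MForm.inChart_apply_self` (`ManifoldFormsChart`, `C^∞` atlas), kept
private. [folklore] -/
private theorem MForm.inChart_apply_base (α : MForm I M F 1) (x₀ : M) (w : Fin 1 → E) :
    α.inChart x₀ (extChartAt I x₀ x₀) w = α x₀ w := by
  rw [MForm.inChart_apply, mfderivWithin_range_extChartAt_symm]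
  exact α.apply_eq_of_eq_point (extChartAt_to_inv x₀) w

set_option backward.isDefEq.respectTransparency false in
/-- The manifold Lie bracket at `x₀` is the bracket of the chart representatives at `z₀`
(definition of `VectorField.mlieBracket`, the derivative of the extended chart at its base point being
the identity). [folklore] -/
theorem mlieBracket_eq_lieBracketWithin_mpullbackWithin (x₀ : M) (Y₀ Y₁ : Π x : M, TangentSpace I x) :
    mlieBracket I Y₀ Y₁ x₀ =
      lieBracketWithin ℝ (mpullbackWithin 𝓘(ℝ, E) I (extChartAt I x₀).symm Y₀ (range I))
        (mpullbackWithin 𝓘(ℝ, E) I (extChartAt I x₀).symm Y₁ (range I)) (range I)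
        (extChartAt I x₀ x₀) := by
  rw [← mlieBracketWithin_univ, mlieBracketWithin_apply, mfderiv_extChartAt_self,
    ContinuousLinearMap.inverse_id, preimage_univ, univ_inter]
  rfl

/-! ### Warner's formula 2.25 (f) in degree one -/

/-- **The exterior derivative of a 1-form on two vector fields** (Warner 1983, Prop. 2.25 (f),
`p = 1`): on a `C²` manifold with complete model space, for a 1-form `ω` whose chart representative
at `x₀` is differentiable within `range I` at the image of `x₀` and vector fields `Y₀, Y₁`
differentiable at `x₀`,

  `dω_{x₀}(Y₀ x₀, Y₁ x₀) = d(ω(Y₁))_{x₀}(Y₀ x₀) - d(ω(Y₀))_{x₀}(Y₁ x₀) - ω_{x₀}([Y₀, Y₁] x₀)`,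

with the tree's `mextDeriv` (Mathlib's normalisation of `d`, which is Warner's), Mathlib's
`mvfderiv` for the derivative of the `F`-valued functions `y ↦ ω_y(Y_i y)` and
`VectorField.mlieBracket`. Proof: in the extended chart at `x₀` this is Mathlib's expansion of
`extDerivWithin` (`extDerivWithin_apply`) plus the derivative of an evaluation
(`fderivWithin_continuousAlternatingMap_apply_apply`), the two correction terms combining to the
bracket of the representatives; all identifications at the base point are identities.
[cite: Warner1983, Prop. 2.25(f)] -/
theorem mextDeriv_apply_vectorField [CompleteSpace E] {α : MForm I M F 1} {x₀ : M}
    (hα : DifferentiableWithinAt ℝ (α.inChart x₀) (range I) (extChartAt I x₀ x₀))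
    {Y₀ Y₁ : Π x : M, TangentSpace I x}
    (hY₀ : MDifferentiableAt I (I.prod 𝓘(ℝ, E)) (fun y ↦ (Y₀ y : TangentBundle I M)) x₀)
    (hY₁ : MDifferentiableAt I (I.prod 𝓘(ℝ, E)) (fun y ↦ (Y₁ y : TangentBundle I M)) x₀) :
    mextDeriv α x₀ ![Y₀ x₀, Y₁ x₀] =
      mvfderiv I (fun y ↦ α y ![Y₁ y]) x₀ (Y₀ x₀) - mvfderiv I (fun y ↦ α y ![Y₀ y]) x₀ (Y₁ x₀)
        - α x₀ ![mlieBracket I Y₀ Y₁ x₀] := by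
  set φ := extChartAt I x₀ with hφ
  set z₀ : E := φ x₀ with hz₀
  set W₀ : E → E := mpullbackWithin 𝓘(ℝ, E) I φ.symm Y₀ (range I) with hW₀
  set W₁ : E → E := mpullbackWithin 𝓘(ℝ, E) I φ.symm Y₁ (range I) with hW₁
  set αc := α.inChart x₀ with hαc
  have hU : UniqueDiffWithinAt ℝ (range I) z₀ :=
    I.uniqueDiffOn _ (extChartAt_target_subset_range x₀ (mem_extChartAt_target x₀))
  have hWd : ∀ {Y : Π x : M, TangentSpace I x},
      MDifferentiableAt I (I.prod 𝓘(ℝ, E)) (fun y ↦ (Y y : TangentBundle I M)) x₀ →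
      DifferentiableWithinAt ℝ (mpullbackWithin 𝓘(ℝ, E) I φ.symm Y (range I)) (range I) z₀ := by
    intro Y hY
    have h := MDifferentiableWithinAt.differentiableWithinAt_mpullbackWithin_vectorField (I := I)
      (s := univ) (V := Y) (x := x₀) (mdifferentiableWithinAt_univ.2 hY)
    simpa only [preimage_univ, univ_inter] using h
  have hW₀d : DifferentiableWithinAt ℝ W₀ (range I) z₀ := hWd hY₀
  have hW₁d : DifferentiableWithinAt ℝ W₁ (range I) z₀ := hWd hY₁
  have hW₀0 : W₀ z₀ = Y₀ x₀ := mpullbackWithin_extChartAt_symm_apply_self x₀ Y₀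
  have hW₁0 : W₁ z₀ = Y₁ x₀ := mpullbackWithin_extChartAt_symm_apply_self x₀ Y₁
  -- the left-hand side in the chart
  have hL : mextDeriv α x₀ ![Y₀ x₀, Y₁ x₀] = extDerivWithin αc (range I) z₀ ![W₀ z₀, W₁ z₀] := by
    change (extDerivWithin αc (range I) z₀).compContinuousLinearMap (mfderiv I 𝓘(ℝ, E) φ x₀) ![Y₀ x₀, Y₁ x₀] = _
    rw [mfderiv_extChartAt_self, ContinuousAlternatingMap.compContinuousLinearMap_apply, hW₀0, hW₁0]
    rfl
  -- Mathlib's expansion of `extDerivWithin` on the pair `(W₀ z₀, W₁ z₀)`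
  have hrem0 : Fin.removeNth (0 : Fin 2) (![W₀ z₀, W₁ z₀] : Fin 2 → E) = fun _ ↦ W₁ z₀ := by
    funext j; fin_cases j; rfl
  have hrem1 : Fin.removeNth (1 : Fin 2) (![W₀ z₀, W₁ z₀] : Fin 2 → E) = fun _ ↦ W₀ z₀ := by
    funext j; fin_cases j; rfl
  have hexp : extDerivWithin αc (range I) z₀ ![W₀ z₀, W₁ z₀] =
      fderivWithin ℝ αc (range I) z₀ (W₀ z₀) (fun _ ↦ W₁ z₀)
        - fderivWithin ℝ αc (range I) z₀ (W₁ z₀) (fun _ ↦ W₀ z₀) := by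
    rw [extDerivWithin_apply hα hU, Fin.sum_univ_two, hrem0, hrem1,
      fderivWithin_continuousAlternatingMap_apply_const_apply hU hα,
      fderivWithin_continuousAlternatingMap_apply_const_apply hU hα]
    simp only [Fin.val_zero, pow_zero, one_smul, Fin.val_one, pow_one, neg_smul, Matrix.cons_val_zero,
      Matrix.cons_val_one]
    abel
  -- the derivatives of the evaluations `z ↦ αc z (W_i z)`
  have hev : ∀ {W : E → E}, DifferentiableWithinAt ℝ W (range I) z₀ → ∀ u : E,
      fderivWithin ℝ (fun z ↦ αc z (fun _ ↦ W z)) (range I) z₀ u =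
        fderivWithin ℝ αc (range I) z₀ u (fun _ ↦ W z₀) + αc z₀ (fun _ ↦ fderivWithin ℝ W (range I) z₀ u) := by
    intro W hW u
    have h := fderivWithin_continuousAlternatingMap_apply_apply (g := fun _ : Fin 1 ↦ W) hα (fun _ ↦ hW) hU u
    simp only [Fin.sum_univ_one, Function.update_eq_const_of_subsingleton] at h
    exact h
  -- the right-hand side in the chart
  have hR₀ : mvfderiv I (fun y ↦ α y ![Y₁ y]) x₀ (Y₀ x₀) =
      fderivWithin ℝ αc (range I) z₀ (W₀ z₀) (fun _ ↦ W₁ z₀) + αc z₀ (fun _ ↦ fderivWithin ℝ W₁ (range I) z₀ (W₀ z₀)) := by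
    rw [MForm.mvfderiv_apply_vectorField hα hY₁, ← hW₀0]
    exact hev hW₁d (W₀ z₀)
  have hR₁ : mvfderiv I (fun y ↦ α y ![Y₀ y]) x₀ (Y₁ x₀) =
      fderivWithin ℝ αc (range I) z₀ (W₁ z₀) (fun _ ↦ W₀ z₀) + αc z₀ (fun _ ↦ fderivWithin ℝ W₀ (range I) z₀ (W₁ z₀)) := by
    rw [MForm.mvfderiv_apply_vectorField hα hY₀, ← hW₁0]
    exact hev hW₀d (W₁ z₀)
  have hB : α x₀ ![mlieBracket I Y₀ Y₁ x₀] =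
      αc z₀ (fun _ ↦ fderivWithin ℝ W₁ (range I) z₀ (W₀ z₀))
        - αc z₀ (fun _ ↦ fderivWithin ℝ W₀ (range I) z₀ (W₁ z₀)) := by
    rw [mlieBracket_eq_lieBracketWithin_mpullbackWithin, lieBracketWithin, Matrix.vec_single_eq_const,
      ← MForm.inChart_apply_base α x₀, ContinuousAlternatingMap.apply_const_sub]
  rw [hL, hexp, hR₀, hR₁, hB]
  abel

end Chart

end Literature.Geometry.Kaehler
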